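import Summits.RiemannHypothesis.RiemannHypothesis.Theorems.TiltedLandingLaw421R3Lens1PinningTol

/-! # trkD_v14qRT — FINAL FORM (C1 rh-idea-5 g41, files-only). ELABORATES ONLY AFTER (CA1164) S1 has added the Theses decl
`Summit.RiemannHypothesis.RiemannHypothesis.Theses.EarlyAppointments.TiltedLandingLaw421RT` (tenure g22 sig 9f786167 verbatim: ⟨33346⟩'s
`TiltedLandingLaw421R` with ONE binder `2 * (Hs + hmax) ≤ R` inserted after `2 * Hs ≤ R`).  Content = the REGISTERED v14q′ line
(`Cruxes/TiltedLandingLaw421R/Lines/trkD_v14qP.lean`): the same four stubs on θ₀ = 1/10 and the same sorry-free composition `TiltedLandingLaw421R_of`,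
plus `TiltedLandingLaw421RT_of` = that composition with the new (unused) binder dropped — kernel-trivial, no new stub, no new mathematics.
The DRAFT twin `trkD_v14qRT-DRAFT-…` (66005bad) is byte-identical except that it concludes a local stand-in def and therefore elaborates today
(farm rc 0, sorries = 4 = stubs).  REGISTRATION (a seat WITH verbs, after S1–S3): `lean check` this file (expect rc 0, sorries 4, 0 errors; if S1's
binder NAMES/ORDER differ from 9f786167, fix the `intro` line only), then `ledger crux write <RT-item> Lines/trkD_v14qRT.lean --file <this>` and
`ledger skeleton check $(ledger crux dir <RT-item>)/Lines/trkD_v14qRT.lean --crux <RT-item>`.  NOT a registration; nothing here bears on the truth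
of RH; RH is not proved; ⟨33346⟩/⟨33347⟩ OPEN. -/
namespace Summit.RiemannHypothesis.RiemannHypothesis.Cruxes.TiltedLandingLaw421RT.TrkDV14qRT

/-- stub 1′ (SUCC, repaired per (CA920)(2)/(CA923)): top-of-cluster pinning with height tolerance θ₀ = 1/10. (v14q′ VERBATIM) -/
theorem stub_topPinningTol : RhW08.Lens1PinningTol.TopPinningTol (1 / 10) := by sorry

/-- stub 2 (SUCC residual, v13q stub 2 VERBATIM): the strictly-taller umbrella. -/
theorem stub_regUmbrella11S : RhW08.Lens1Pinning.RegUmbrella11S := by sorry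

/-- stub 2′ (SUCC residual, same θ₀): the low umbrella — a pinned out-of-band toucher within the tolerance ⇒ successor. (v14q′ VERBATIM) -/
theorem stub_regUmbrellaLowS : RhW08.Lens1PinningTol.RegUmbrellaLowS (1 / 10) := by sorry

/-- stub 3 (RATE at the ½-purse, v14q r0 stub 3 VERBATIM). -/
theorem stub_restRateBotHalf : RhW08.PurseP.RestRateBotPQ RhW08.PurseP.halfPurse := by sorry

/-- COMPOSITION for the OLD crux (v14q′ VERBATIM; sorry-free, concludes ⟨33346⟩ `TiltedLandingLaw421R` BY NAME). -/
theorem TiltedLandingLaw421R_of :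
    Summit.RiemannHypothesis.RiemannHypothesis.Theses.EarlyAppointments.TiltedLandingLaw421R :=
  RhW08.PurseP.law421Half_of_succ_rate
    (RhW08.Lens1Coverage.restSuccBotQ_of_resS (RhW08.Lens1Coverage.regRes8S_of_regHungCut10S
      (RhW08.Lens1PinningTol.regHungCut10S_of_topPinningTol stub_topPinningTol stub_regUmbrella11S stub_regUmbrellaLowS)))
    stub_restRateBotHalf

/-- COMPOSITION for the RESTATED crux (sorry-free): `RT` = `R` with one extra, unused binder `2 * (Hs + hmax) ≤ R`. -/
theorem TiltedLandingLaw421RT_of :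
    Summit.RiemannHypothesis.RiemannHypothesis.Theses.EarlyAppointments.TiltedLandingLaw421RT := by
  unfold Summit.RiemannHypothesis.RiemannHypothesis.Theses.EarlyAppointments.TiltedLandingLaw421RT
  intro η f x₀ s hmax R Hs B hd hreal hgr hs h2s h2h h3h hHs hstrip h2Hs _hHR hpair hcol hhalf hη h2η hrem
  have h := TiltedLandingLaw421R_of
  unfold Summit.RiemannHypothesis.RiemannHypothesis.Theses.EarlyAppointments.TiltedLandingLaw421R at h
  exact h η f x₀ s hmax R Hs B hd hreal hgr hs h2s h2h h3h hHs hstrip h2Hs hpair hcol hhalf hη h2η hrem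

end Summit.RiemannHypothesis.RiemannHypothesis.Cruxes.TiltedLandingLaw421RT.TrkDV14qRT
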